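import Summits.PneNP.PneNP.Theses.PositionalGames
import Summits.PneNP.PneNP.Theorems.PositionalGamesMpgTargetOfCruxes
import Literature.Combinatorics.Games.MeanPayoffGame
import HarnessLib

/-!
# Repair (crux-strategist cstrat-stmt-PneNP-1292-r1): the pre-typed REPAIR of piece T-cap and its glue

If the registered piece `MpgNoMonotoneGap` (T-cap, stmt-PneNP-1296: instance-level "no monotone gap for EVERY
mean-payoff template") is refuted through its one-player sub-case (refuter objection SUSPECT_Tcap_PneNP-1296.md:
a Tardos-type gap for binary-weight min/max-mean-cycle threshold, a function in P), the decomposition of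
`MpgGeneralSuperpoly` survives with the CLASS-LEVEL no-gap statement `MpgNoMonotoneGapMax` below
("the monotone complexity of every size-`n` template is polynomially bounded by the general complexity of SOME
size-`n` template" = max-over-templates form named in the route header and by the refuter as the repair; all the
glue needs). This file types it over the Literature definition `MeanPayoffGame.winFn` (= the route's inlined
lambda, `MeanPayoffGame.winFn_eq_fin`) and proves the replacement glue
`MpgMonotoneSuperpoly → MpgNoMonotoneGapMax → MpgGeneralSuperpoly` sorry-free, so a tenure `--resplit` is one
command. It is weaker than T-cap (`mpgNoMonotoneGapMax_of_noGap`).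
-/

set_option linter.dupNamespace false

namespace Summit.PneNP.PneNP.Cruxes.MpgGeneralSuperpoly.Repair

open Literature.Computability.Complexity Literature.Combinatorics.Games Filter
open Summit.PneNP.PneNP.Theses.PositionalGames (MpgMonotoneSuperpoly MpgNoMonotoneGap MpgGeneralSuperpoly)

open scoped Classical

/-- **T-cap, class-level (max-over-templates) form.** `∃ c, ∀ᶠ n, ∀ o v, ∃ o' v',
mSIZE(MPGWIN n o v) ≤ n ^ c · SIZE_B2(MPGWIN n o' v') ^ c`: the monotone complexity of every mean-payoff template
on `Fin n` is polynomially bounded by the GENERAL complexity of some template on `Fin n` ("mean-payoff games, as a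
problem, have no monotone/general gap"). Refutable only by polynomial general circuits for the hardest templates
together with a superpolynomial monotone lower bound — not by a one-player gap alone. [conjecture — repair form] -/
def MpgNoMonotoneGapMax : Prop :=
  ∃ c : ℕ, ∀ᶠ n : ℕ in atTop, ∀ (o : Fin n → Bool) (v : Fin n), ∃ (o' : Fin n → Bool) (v' : Fin n),
    circuitSizeOver monotoneBasis (MeanPayoffGame.winFn n o v (2 ^ (n - 1))) ≤
      n ^ c * circuitSizeOver B2 (MeanPayoffGame.winFn n o' v' (2 ^ (n - 1))) ^ c

/-- The instance-level T-cap implies the class-level form (take `o' = o`, `v' = v`). [folklore] -/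
theorem mpgNoMonotoneGapMax_of_noGap (h : MpgNoMonotoneGap) : MpgNoMonotoneGapMax := by
  obtain ⟨c, hc⟩ := h
  refine ⟨c, ?_⟩
  filter_upwards [hc] with n hn o v
  refine ⟨o, v, ?_⟩
  have := hn o v
  simp only [MeanPayoffGame.winFn_eq_fin]
  exact this

/-- **Replacement glue**: `MpgMonotoneSuperpoly → MpgNoMonotoneGapMax → MpgGeneralSuperpoly` — same arithmetic as
`mpgTargetOfCruxes_proof`, the witness template of X being the `(o', v')` supplied by the class-level no-gap
statement for the monotone-hard template `(o, v)` of M2. [folklore] -/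
theorem mpgGeneralSuperpoly_of_monotone_of_noGapMax (hM : MpgMonotoneSuperpoly) (hT : MpgNoMonotoneGapMax) :
    MpgGeneralSuperpoly := by
  unfold Summit.PneNP.PneNP.Theses.PositionalGames.MpgGeneralSuperpoly
  unfold Summit.PneNP.PneNP.Theses.PositionalGames.MpgMonotoneSuperpoly at hM
  intro k
  obtain ⟨c, hc⟩ := hT
  refine Filter.Eventually.frequently ?_
  filter_upwards [hM (c * (k + 1)), hc] with n hn hcn
  obtain ⟨o, v, hlt⟩ := hn
  obtain ⟨o', v', hle⟩ := hcn o v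
  simp only [MeanPayoffGame.winFn_eq_fin] at hle
  exact ⟨o', v', Summit.PneNP.PneNP.Theorems.mpgTargetOfCruxes_arith hlt hle⟩

end Summit.PneNP.PneNP.Cruxes.MpgGeneralSuperpoly.Repair
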